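import Mathlib
import Summits.AtomisticToContinuum.Crystallization.Theses.PhononSlackCertificates
import Summits.AtomisticToContinuum.Crystallization.Theorems.PhononSlackCertificatesNearFarGlueRLooseExhaustion
import Summits.AtomisticToContinuum.Crystallization.Theorems.NearFarGlueR.Negative.GlueToolkit
import Summits.AtomisticToContinuum.Crystallization.Theorems.PhononSlackCertificatesNearFarGlueRFibre
import Literature.MathematicalPhysics.StatisticalMechanics.LennardJonesClusters

/-!
# Crux `PhononSlackCertificates.NearFarGlueR` (stmt-AtomisticToContinuum-14970), line `Sketch`:
the TARGET, too, may assume net-bound configurations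

Continuation lead c3; part 3c of the loose-particle species (registered sub-goal
`stub_looseTarget` of the crux item).  The same loose exhaustion (part 3a) that normalises the
residual normalises the route's target `CoerciveTwoShellGap` (the conclusion of the crux): bad
particles transfer along the stripping, `#bad(x) ≤ 1332·(N − K) + #bad(x ∘ f)`
(`card_bad_le_strip`: a bad particle of `x` is stripped, or within `3/2` of a stripped particle — at
most `(2·(3/2)/(3/10) + 1)³ = 1331` kept ones per stripped one, `fibre_count_on` — or bad already in
the core, `good_of_good_comp`), hence

* `coercive_ineq_of_netBound`: if `K·e* + g·#bad(z) ≤ 𝓔(z)` with one `g ≥ 0` for every NET-BOUND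
  injective `z` (all `A_k(z) < 0`; such `z` are `3/10`-separated and contain no unbound particle),
  then `N·e* + min g (711/1332000)·#bad(x) ≤ 𝓔(x)` for EVERY finite injective `x`;
* `coerciveTwoShellGap_iff_netBound`: the target is equivalent to its net-bound instance.

(The tree's `coerciveTwoShellGap_iff_sepTwoShellGap` removes separation by closest-pair deletion;
the net-bound normalisation is stronger — it also removes every particle whose attraction does not
beat half its repulsion plus `0.711`.)  All `[folklore]`.
-/

noncomputable section

namespace Summit.AtomisticToContinuum.Crystallization.Theorems.PhononSlackCertificatesNearFarGlueR

open Literature.MathematicalPhysics.StatisticalMechanics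
open Literature.Geometry.DiscreteGeometry
open Summit.AtomisticToContinuum.Crystallization.Theses.PhononSlackCertificates
open Summit.AtomisticToContinuum.Crystallization.Theorems.NearFarGlueRNegative (good_of_good_comp)
open scoped BigOperators

/-- **Bad-count transfer under stripping.**  For `f : Fin K ↪ Fin N` with `x ∘ f` `3/10`-separated:
`#bad(x) ≤ 1332·(N − K) + #bad(x ∘ f)`. [folklore] -/
theorem card_bad_le_strip {N K : ℕ} (x : Fin N → EuclideanSpace ℝ (Fin 3)) (f : Fin K ↪ Fin N)
    (hsep : ∀ k l : Fin K, k ≠ l → (3 / 10 : ℝ) ≤ dist (x (f k)) (x (f l))) :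
    (Nat.card {i : Fin N // ¬ IsTwoShellGood (1 / 20) (47 / 50) 1 x i} : ℝ) ≤
      1332 * ((N : ℝ) - K) +
        (Nat.card {k : Fin K // ¬ IsTwoShellGood (1 / 20) (47 / 50) 1 (x ∘ f) k} : ℝ) := by
  classical
  set Rm : Finset (Fin N) := (Finset.univ.map f)ᶜ with hRm
  set B := Finset.univ.filter fun i : Fin N => ¬ IsTwoShellGood (1 / 20) (47 / 50) 1 x i with hB
  set BK := Finset.univ.filter fun k : Fin K => ¬ IsTwoShellGood (1 / 20) (47 / 50) 1 (x ∘ f) k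
    with hBK
  set S := (Finset.univ.map f).filter fun j : Fin N => ∃ w ∈ Rm, dist (x j) (x w) ≤ 3 / 2 with hS
  rw [Nat.card_eq_fintype_card, Fintype.card_subtype, Nat.card_eq_fintype_card, Fintype.card_subtype]
  change ((B.card : ℕ) : ℝ) ≤ 1332 * ((N : ℝ) - K) + ((BK.card : ℕ) : ℝ)
  have hRmcard : (Rm.card : ℝ) = (N : ℝ) - K := by
    rw [hRm, Finset.card_compl, Finset.card_map, Finset.card_univ, Fintype.card_fin, Fintype.card_fin,
      Nat.cast_sub (by simpa using (Finset.univ.map f).card_le_univ)]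
  have hrange : ∀ j : Fin N, j ∉ Rm ↔ j ∈ Set.range f := fun j => by
    simp only [hRm, Finset.mem_compl, not_not, Finset.mem_map, Finset.mem_univ, true_and,
      Set.mem_range]
  have hSle : (S.card : ℝ) ≤ (2 * (3 / 2) / (3 / 10) + 1) ^ 3 * (Rm.card : ℝ) := by
    refine fibre_count_on (by norm_num) (by norm_num) x S Rm (fun i hi j hj hij => ?_) fun j hj => ?_
    · obtain ⟨k, -, rfl⟩ := Finset.mem_map.1 (Finset.mem_filter.1 hi).1
      obtain ⟨l, -, rfl⟩ := Finset.mem_map.1 (Finset.mem_filter.1 hj).1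
      exact hsep k l fun h => hij (by rw [h])
    · obtain ⟨w, hw, hd⟩ := (Finset.mem_filter.1 hj).2
      exact ⟨w, hw, hd⟩
  have h11 : (2 * (3 / 2 : ℝ) / (3 / 10) + 1) ^ 3 = 1331 := by norm_num
  rw [h11] at hSle
  have hcover : B ⊆ Rm ∪ S ∪ BK.map f := by
    intro i hi
    have hbad := (Finset.mem_filter.1 hi).2
    by_cases hiR : i ∈ Rm
    · exact Finset.mem_union_left _ (Finset.mem_union_left _ hiR)
    · have hif : i ∈ Finset.univ.map f := by simpa [hRm] using hiR
      by_cases hsp : ∃ w ∈ Rm, dist (x i) (x w) ≤ 3 / 2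
      · exact Finset.mem_union_left _ (Finset.mem_union_right _ (Finset.mem_filter.2 ⟨hif, hsp⟩))
      · push Not at hsp
        obtain ⟨k, rfl⟩ := (hrange _).1 hiR
        refine Finset.mem_union_right _ (Finset.mem_map.2 ⟨k, Finset.mem_filter.2 ⟨Finset.mem_univ _, ?_⟩, rfl⟩)
        intro hgood
        refine hbad (good_of_good_comp x f k (fun w hw => ?_) hgood)
        have hwR : w ∈ Rm := by
          by_contra h; exact hw ((hrange w).1 h)
        have := hsp w hwR
        rw [dist_comm]; linarith
  have h1 : B.card ≤ (Rm ∪ S).card + (BK.map f).card :=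
    (Finset.card_le_card hcover).trans (Finset.card_union_le _ _)
  have h2 : (Rm ∪ S).card ≤ Rm.card + S.card := Finset.card_union_le _ _
  have h3 : (BK.map f).card = BK.card := Finset.card_map _
  have h4 : (B.card : ℝ) ≤ Rm.card + S.card + BK.card := by
    have : B.card ≤ Rm.card + S.card + BK.card := by omega
    exact_mod_cast this
  rw [hRmcard] at hSle h4
  linarith

/-- **The target reduces to net-bound configurations.**  If `K·e* + g·#bad(z) ≤ 𝓔(z)` for every
net-bound injective `z` with one `g ≥ 0`, then `N·e* + min g (711/1332000)·#bad(x) ≤ 𝓔(x)` for every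
finite injective `x`. [folklore] -/
theorem coercive_ineq_of_netBound {g : ℝ} (hg : 0 ≤ g)
    (H : ∀ (K : ℕ) (z : Fin K → EuclideanSpace ℝ (Fin 3)), Function.Injective z →
      (∀ k : Fin K, ∑ l ∈ Finset.univ.erase k,
        (min (lennardJones (dist (z k) (z l))) 0 + (1 / 2 : ℝ) * max (lennardJones (dist (z k) (z l))) 0) < 0) →
      (K : ℝ) * (⨅ Q : PeriodicConfiguration 3, Q.energyPerParticle lennardJones) +
          g * (Nat.card {k : Fin K // ¬ IsTwoShellGood (1 / 20) (47 / 50) 1 z k} : ℝ) ≤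
        interactionEnergy lennardJones z)
    {N : ℕ} (x : Fin N → EuclideanSpace ℝ (Fin 3)) (hx : Function.Injective x) :
    (N : ℝ) * (⨅ Q : PeriodicConfiguration 3, Q.energyPerParticle lennardJones) +
        min g (711 / 1332000) * (Nat.card {i : Fin N // ¬ IsTwoShellGood (1 / 20) (47 / 50) 1 x i} : ℝ) ≤
      interactionEnergy lennardJones x := by
  obtain ⟨K, f, hnet, hE⟩ := exists_netBound_core N x hx
  have hzinj : Function.Injective (x ∘ f) := hx.comp f.injective
  have hsep : ∀ k l : Fin K, k ≠ l → (3 / 10 : ℝ) ≤ dist (x (f k)) (x (f l)) :=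
    sep_of_netBound (x ∘ f) hzinj hnet
  have hH := H K (x ∘ f) hzinj hnet
  have hcount := card_bad_le_strip x f hsep
  set m : ℝ := min g (711 / 1332000) with hm
  have hm0 : 0 ≤ m := le_min hg (by norm_num)
  have hmg : m ≤ g := min_le_left _ _
  have hm2 : m * 1332 ≤ 711 / 1000 := by
    have : m ≤ 711 / 1332000 := min_le_right _ _
    linarith
  set bN : ℝ := (Nat.card {i : Fin N // ¬ IsTwoShellGood (1 / 20) (47 / 50) 1 x i} : ℝ) with hbN
  set bK : ℝ := (Nat.card {k : Fin K // ¬ IsTwoShellGood (1 / 20) (47 / 50) 1 (x ∘ f) k} : ℝ) with hbK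
  have hbK0 : 0 ≤ bK := Nat.cast_nonneg _
  have hNK : 0 ≤ (N : ℝ) - K := by
    have : K ≤ N := by simpa using Fintype.card_le_of_embedding f
    have : (K : ℝ) ≤ N := by exact_mod_cast this
    linarith
  have h1 : m * bN ≤ m * bK + m * 1332 * ((N : ℝ) - K) := by
    have := mul_le_mul_of_nonneg_left hcount hm0
    nlinarith [this]
  have h2 : m * bK ≤ g * bK := mul_le_mul_of_nonneg_right hmg hbK0
  have h3 : m * 1332 * ((N : ℝ) - K) ≤ (711 / 1000 : ℝ) * ((N : ℝ) - K) :=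
    mul_le_mul_of_nonneg_right hm2 hNK
  have hH' : (K : ℝ) * (⨅ Q : PeriodicConfiguration 3, Q.energyPerParticle lennardJones) + g * bK ≤
      interactionEnergy lennardJones (x ∘ f) := hH
  linarith [hE, hH', h1, h2, h3]

/-- **The target is equivalent to its net-bound instance.** [folklore] -/
theorem coerciveTwoShellGap_iff_netBound :
    CoerciveTwoShellGap ↔
    (∃ g : ℝ, 0 < g ∧ ∀ (N : ℕ) (x : Fin N → EuclideanSpace ℝ (Fin 3)), Function.Injective x →
      (∀ j : Fin N, ∑ k ∈ Finset.univ.erase j,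
        (min (lennardJones (dist (x j) (x k))) 0 + (1 / 2 : ℝ) * max (lennardJones (dist (x j) (x k))) 0) < 0) →
      (N : ℝ) * (⨅ Q : PeriodicConfiguration 3, Q.energyPerParticle lennardJones) +
          g * (Nat.card {i : Fin N // ¬ IsTwoShellGood (1 / 20) (47 / 50) 1 x i} : ℝ) ≤
        interactionEnergy lennardJones x) := by
  constructor
  · intro h
    obtain ⟨g, hg, H⟩ := h (3 / 10) (by norm_num)
    exact ⟨g, hg, fun N x hx hnet => H N x (sep_of_netBound x hx hnet)⟩
  · rintro ⟨g, hg, H⟩ δ hδ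
    refine ⟨min g (711 / 1332000), lt_min hg (by norm_num), fun N x hsep => ?_⟩
    exact coercive_ineq_of_netBound hg.le H x (fibre_injective_of_separated hδ hsep)

/-- **Registered sub-goal `stub_looseTarget` of the crux item** (skeleton `Lines/Sketch.lean`, c3):
the target is equivalent to its net-bound instance — `coerciveTwoShellGap_iff_netBound` in closed
form. [folklore] -/
theorem stub_looseTarget :
    (CoerciveTwoShellGap ↔
    (∃ g : ℝ, 0 < g ∧ ∀ (N : ℕ) (x : Fin N → EuclideanSpace ℝ (Fin 3)), Function.Injective x →
      (∀ j : Fin N, ∑ k ∈ Finset.univ.erase j,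
        (min (lennardJones (dist (x j) (x k))) 0 + (1 / 2 : ℝ) * max (lennardJones (dist (x j) (x k))) 0) < 0) →
      (N : ℝ) * (⨅ Q : PeriodicConfiguration 3, Q.energyPerParticle lennardJones) +
          g * (Nat.card {i : Fin N // ¬ IsTwoShellGood (1 / 20) (47 / 50) 1 x i} : ℝ) ≤
        interactionEnergy lennardJones x)) :=
  coerciveTwoShellGap_iff_netBound

end Summit.AtomisticToContinuum.Crystallization.Theorems.PhononSlackCertificatesNearFarGlueR

end
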